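import Summits.BirchSwinnertonDyer.BirchSwinnertonDyer.Theses.KatoDescentPotSupersingular
import Summits.BirchSwinnertonDyer.Rank1Residual.O6.PotGoodOfHullKMC
import HarnessLib

/-!
# Route `KatoDescentPotSupersingular` (rung K9, cell `bsd-potss`): the crux `WildLowerHalfRankZero`
# (L₀, item stmt-BirchSwinnertonDyer-19195) FROM KMC₃ IN HULL CURRENCY — the DescentGlue over the SAME
# reading family as crux M, with no torsion-free member and no Mazur–Kenku walk (a `--supports … --as helper` file)

Route.md, two-layer plan: "WildLowerHalfRankZero ⇐ (KMC_p as a closed Prop, D-O6-2) → (KMC_p ⇒ lower half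
at the torsion-free member: kernel theorem `Additive.potGoodLowerHalfRankZero_of_kmc_torsionFree`,
p408212)". Seat kmc part 14 (`S/O6/X3KatoMemberBoundExactCount.lean`, p419205) makes the torsion-free detour
unnecessary: the rank-`0` Kato count at ANY hull-realised member is EXACT (`ord₃ #Ш_an = ord₃ #Ш + m`,
`3^m` = Kato's `μ`), so `KMC₃(W') ⟹ BSD₃(W')` there whatever the rational `3`-torsion
(`KatoHull.bsdp_of_kmc`), and Cassels carries `BSD₃` to the given curve. This file restates the hull-currency
glue `O6.wildLowerHalfRankZero_of_hullKMC` (part 14e, `S/O6/PotGoodOfHullKMC.lean`) with the ROUTE DECL as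
its type: `WildLowerHalfRankZero` over Reading M1♯ (`KatoHull.Realizable`: a hull datum at some member of
every additive potentially good class), Reading M3♯ (`KatoHull.ExactCountReading`), the interface lemma
`KatoHull.ReadsKMC`, the named facts Cassels / GZK / modularity, and KMC₃ at the wild curves (hypothesis
`hKMC`; a class invariant, part 13). CONDITIONAL (audit `proof.conditional`); nothing about Kato's objects or
his Main Conjecture is asserted; the item is NOT closed. Seat `bsd-potss-kmc` generation 7.

References: [Kato2004Asterisque] Conj. 12.10 (p. 224), Thm. 12.6 (p. 222), §14.14 (p. 243), Prop. 14.16 (2)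
(p. 244); [Wuthrich2014] §3.2 (p. 394); [Cassels1965ArithmeticVIII]; [Miller2011LMS] Def. 1.1.
-/

set_option autoImplicit false
-- sibling precedent (`KatoDescentPotSupersingularAssembly.lean`): the directory name repeats the summit name
set_option linter.dupNamespace false

noncomputable section

open scoped Classical

namespace Summit.BirchSwinnertonDyer.BirchSwinnertonDyer.Theorems

open WeierstrassCurve Literature.NumberTheory.EllipticCurves
  Literature.NumberTheory.EllipticCurves.Rank1Residual
  Literature.NumberTheory.EllipticCurves.Rank1Residual.Typed
  Summit.BirchSwinnertonDyer.Rank1Residual.Additive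
  Summit.BirchSwinnertonDyer.Rank1Residual
  Summit.BirchSwinnertonDyer.BirchSwinnertonDyer.Theses.KatoDescentPotSupersingular

variable {IsHullOf : ∀ (W : WeierstrassCurve ℚ) [W.IsElliptic] [W.IsGloballyMinimal] (p : ℕ)
  [Fact p.Prime], KatoHullDescentDatum p → Prop}
variable {KMC : ∀ (W : WeierstrassCurve ℚ) [W.IsElliptic] [W.IsGloballyMinimal] (p : ℕ), Prop}

/-- **DescentGlue for the crux `WildLowerHalfRankZero` in hull currency: KMC₃ at the wild curves of analytic
rank `0` ⟹ L₀**, over Reading M1♯, Reading M3♯, the interface lemma `ReadsKMC`, and Cassels / GZK /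
modularity — by `O6.wildLowerHalfRankZero_of_hullKMC` (type = the route decl verbatim). No torsion-free
member, no Mazur–Kenku. Conditional over displayed hypotheses; nothing about Kato's objects is asserted;
the item is not closed. [cite: Kato2004Asterisque, Conj. 12.10 (p. 224), §14.14 (p. 243), Prop. 14.16 (2) (p. 244)]
[cite: Cassels1965ArithmeticVIII] -/
theorem wildLowerHalfRankZero_of_hullKMC (hRz : KatoHull.Realizable IsHullOf)
    (hC : KatoHull.ExactCountReading IsHullOf) (hK : KatoHull.ReadsKMC IsHullOf KMC)
    (hCassels : bsdRHS_eq_of_isIsogenous) (hGZK : rank_eq_analyticRank_of_analyticRank_le_one)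
    (hmod : hasEntireLFunction_rat)
    (hKMC : ∀ (W : WeierstrassCurve ℚ) [W.IsElliptic] [W.IsGloballyMinimal],
      W.analyticRank = 0 → Addv W 3 → 0 ≤ padicValRat 3 W.j → KMC W 3) :
    Summit.BirchSwinnertonDyer.BirchSwinnertonDyer.Theses.KatoDescentPotSupersingular.WildLowerHalfRankZero :=
  fun W _ _ _ hr hO ↦ O6.wildLowerHalfRankZero_of_hullKMC hRz hC hK hCassels hGZK hmod hKMC W hr hO

end Summit.BirchSwinnertonDyer.BirchSwinnertonDyer.Theorems

end
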